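import Mathlib
import HarnessLib
import Summits.Ventures.LatticeQCDFlow.Scoring.ChainHoeffding
import Summits.Ventures.LatticeQCDFlow.Scoring.QuantileBand
import Summits.Ventures.LatticeQCDFlow.Exactness.IMHKernel

/-!
# A UNIFORM BAND for the printed distribution function of a statistic along a DOEBLIN CHAIN, from
# any start: `P_{μ₀}(sup_t |F_π(t) − F̂_N(t)| ≥ η) ≤ 2(⌈2/η⌉ + 1)·exp(−(Nη − 16/ε)²/(128N/ε²))`,
# and with it every sample quantile of the chain output is bracketed at once

HONEST FRAMING: exact (Metropolis-corrected) sampling algorithms for lattice gauge theory;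
figures of merit are autocorrelation/cost numbers at stated couplings and volumes; no
continuum-physics claim.

Venture `LatticeQCDFlow` (cell pub-lqcd), topic `Scoring`; FANOUT row 4 (`s0-u1-b`, rung S0-B).
Row 4's finite-sample bands for the empirical distribution function and for all sample quantiles
(`Scoring/GlivenkoCantelliRate`, `Scoring/QuantileBand`) assume INDEPENDENT draws, while the
output of an exact (Metropolis-corrected) sampler is a Markov chain.  This file removes the
independence: for the simulated chain (Mathlib's `Kernel.trajMeasure`, ANY initial law `μ₀`) of a
Markov kernel `κ` with invariant law `π` and the Doeblin minorisation `κ(x, ·) ≥ ε π`, and any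
measurable real statistic `O`, the empirical distribution function
`F̂_N(t) = #{i<N : O(X_i) ≤ t}/N` of the first `N` states satisfies, for `Nδ ≥ 8/ε`,
**`chain_measureReal_exists_edf_dev_ge_le`**:
`P_{μ₀}(∃ t, δ + 1/K ≤ |F_π(t) − F̂_N(t)|) ≤ 2(K + 1)·exp(−(Nδ − 8/ε)²/(32N/ε²))`
(`F_π = cdf (π ∘ O⁻¹)`, atoms allowed), and the `η`-form
**`chain_measureReal_exists_edf_dev_ge_le_of_pos`** displayed in the title (`Nη ≥ 16/ε`).  The
two ingredients are on the tree: the deterministic one-function quantile-grid sandwich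
`GlivenkoCantelliRate.abs_cdf_sub_lt_of_grid`, and Hoeffding's inequality for a Doeblin chain from
any start, `ChainHoeffding.chain_tail_le_exp_of_doeblin` (row 8), applied to the `2(K + 1)`
indicator observables `1{O > q_j}`, `1{O < q_j}` at the grid points (**`chain_measureReal_cdf_sub_
edf_ge_le`**, **`chain_measureReal_edfStrict_sub_leftLim_ge_le`**; the constant `C' = C + |πf|`
of that inequality is pinned to `2` by the choice `C = 2 − |πf| ≥ 1`).  Corollary
**`chain_measureReal_exists_quantile_unbracketed_le`**: with the same probability bound, every
empirical quantile `q̂_N(u)`, `u ∈ (η, 1 − η)`, lies in `[q_π(u − η), q_π(u + η)]`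
(`QuantileBand.quantile_bracket_of_abs_cdf_sub_lt`).  No stationarity, no independence, no
variance estimate; the supremum event is handled through the outer measure.
NEW WORK of the cell (not a published result); no definition is introduced.
## Content (`P_{μ₀}` the trajectory law; `F_π = cdf (π.map O)`)

* `chain_measureReal_cdf_sub_edf_ge_le`, `chain_measureReal_edfStrict_sub_leftLim_ge_le` —
  the two one-point tails;
* **`chain_measureReal_exists_edf_dev_ge_le`** (grid form), **`…_of_pos`** (`η` form);
* **`chain_measureReal_exists_quantile_unbracketed_le`** — all quantiles at once;
* **`indepMH_measureReal_exists_edf_dev_ge_le`** — the exact flow sampler `indepMH q w`, `w ≤ M`.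

Reading (value-free): a Doeblin certificate `ε` turns `N` updates from any start into an honest
simultaneous band for the whole printed distribution function (histogram, percentile table) of
any real statistic, of width `η` once `Nη ≫ 16/ε`.  NOT CLAIMED: any `ε` for a concrete sampler;
the sharp (DKW–Massart / Bernstein) constants; the reweighted curve of a proposal stream.
-/

noncomputable section

namespace Summit.Ventures.LatticeQCDFlow.Scoring.GlivenkoCantelli

open MeasureTheory ProbabilityTheory Finset Filter Function
open scoped Topology ENNReal

variable {Ω : Type*} [MeasurableSpace Ω]
variable {κ : Kernel Ω Ω} [IsMarkovKernel κ] {μ₀ : Measure Ω} [IsProbabilityMeasure μ₀]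
  {π : Measure Ω} [IsProbabilityMeasure π]

/-! ## §1 The two one-point tails along the chain -/

section Point

/-- **Lower deviation of the chain's empirical distribution function at a point.**  `π`
invariant for `κ`, `κ(x, ·) ≥ ε π` (`ε > 0`), `O` a measurable real statistic,
`F_π = cdf (π ∘ O⁻¹)`; `N ≠ 0`, `Nδ ≥ 8/ε`.  Then from any initial law `μ₀`,
`P_{μ₀}(δ ≤ F_π(t) − #{i<N : O(X_i) ≤ t}/N) ≤ exp(−(Nδ − 8/ε)²/(32N/ε²))`. [ours] (row 8's
`chain_tail_le_exp_of_doeblin` for `f = 1{O > t}`, `|f| ≤ C := 2 − |πf|`, so `C + |πf| = 2`) -/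
theorem chain_measureReal_cdf_sub_edf_ge_le (hπ : Kernel.Invariant κ π) {ε : ℝ≥0∞}
    (hmin : ∀ x {B : Set Ω}, MeasurableSet B → ε * π B ≤ κ x B) (hε0 : 0 < ε)
    {O : Ω → ℝ} (hO : Measurable O) (t : ℝ) {N : ℕ} (hN : N ≠ 0) {δ : ℝ}
    (hδ : 8 / ε.toReal ≤ N * δ) :
    (Kernel.trajMeasure (X := fun _ : ℕ => Ω) μ₀
          (fun m : ℕ => κ.comap (fun y : (i : ↥(Finset.Iic m)) → Ω => y ⟨m, Finset.mem_Iic.2 le_rfl⟩)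
            (measurable_pi_apply _))).real
        {x | δ ≤ cdf (π.map O) t
            - (∑ i ∈ range N, (Set.Iic t).indicator (1 : ℝ → ℝ) (O (x i))) / N}
      ≤ Real.exp (-(N * δ - 8 / ε.toReal) ^ 2 / (32 * N / ε.toReal ^ 2)) := by
  haveI : IsProbabilityMeasure (π.map O) := Measure.isProbabilityMeasure_map hO.aemeasurable
  set P := Kernel.trajMeasure (X := fun _ : ℕ => Ω) μ₀
      (fun m : ℕ => κ.comap (fun y : (i : ↥(Finset.Iic m)) → Ω => y ⟨m, Finset.mem_Iic.2 le_rfl⟩)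
        (measurable_pi_apply _)) with hP
  have hIm : Measurable ((Set.Ioi t).indicator (1 : ℝ → ℝ)) :=
    measurable_one.indicator measurableSet_Ioi
  have hfm : Measurable (fun z => (Set.Ioi t).indicator (1 : ℝ → ℝ) (O z)) := hIm.comp hO
  -- the mean of the observable `1{O > t}` under `π`
  have hint : ∫ z, (Set.Ioi t).indicator (1 : ℝ → ℝ) (O z) ∂π = 1 - cdf (π.map O) t := by
    rw [← integral_map hO.aemeasurable hIm.aestronglyMeasurable,
      integral_indicator_one measurableSet_Ioi, cdf_eq_real, ← Set.compl_Iic,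
      measureReal_compl measurableSet_Iic, probReal_univ]
  have hF0 : 0 ≤ cdf (π.map O) t := cdf_nonneg _ _
  have hF1 : cdf (π.map O) t ≤ 1 := cdf_le_one _ _
  -- `|f| ≤ C := 2 − |πf|`
  have hC : ∀ z, |(Set.Ioi t).indicator (1 : ℝ → ℝ) (O z)|
      ≤ 2 - |∫ z, (Set.Ioi t).indicator (1 : ℝ → ℝ) (O z) ∂π| := by
    intro z
    rw [hint, abs_of_nonneg (indicator_one_nonneg _ _), abs_of_nonneg (by linarith)]
    linarith [indicator_one_le_one (Set.Ioi t) (O z)]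
  have h42 : (4 : ℝ) * 2 = 8 := by norm_num
  have hs : 4 * ((2 - |∫ z, (Set.Ioi t).indicator (1 : ℝ → ℝ) (O z) ∂π|)
      + |∫ z, (Set.Ioi t).indicator (1 : ℝ → ℝ) (O z) ∂π|) / ε.toReal ≤ N * δ := by
    rw [sub_add_cancel, h42]
    exact hδ
  have h := chain_tail_le_exp_of_doeblin (μ₀ := μ₀) hπ hmin hε0 hfm hC hN hs
  beta_reduce at h
  rw [← hP, sub_add_cancel, h42] at h
  -- the event, rewritten through `Σ 1{O > t} = N − Σ 1{O ≤ t}`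
  have hNpos : (0 : ℝ) < N := by exact_mod_cast Nat.pos_of_ne_zero hN
  have hsub : {x : ℕ → Ω | δ ≤ cdf (π.map O) t
        - (∑ i ∈ range N, (Set.Iic t).indicator (1 : ℝ → ℝ) (O (x i))) / N}
      ⊆ {x | δ ≤ (∑ i ∈ range N, (Set.Ioi t).indicator (1 : ℝ → ℝ) (O (x i))) / N
        - ∫ z, (Set.Ioi t).indicator (1 : ℝ → ℝ) (O z) ∂π} := by
    intro x hx
    simp only [Set.mem_setOf_eq] at hx ⊢
    have hsum : ∑ i ∈ range N, (Set.Ioi t).indicator (1 : ℝ → ℝ) (O (x i))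
        = N - ∑ i ∈ range N, (Set.Iic t).indicator (1 : ℝ → ℝ) (O (x i)) := by
      have hi : ∀ i, (Set.Ioi t).indicator (1 : ℝ → ℝ) (O (x i))
          = 1 - (Set.Iic t).indicator (1 : ℝ → ℝ) (O (x i)) := fun i => by
        rw [← Set.compl_Iic, Set.indicator_compl]
        simp
      rw [Finset.sum_congr rfl fun i _ => hi i, Finset.sum_sub_distrib, Finset.sum_const,
        Finset.card_range]
      simp
    rw [hsum, hint, sub_div, div_self hNpos.ne']
    linarith
  refine (measureReal_mono hsub).trans (h.trans (le_of_eq ?_))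
  congr 1
  ring

/-- **Upper deviation of the chain's STRICT empirical distribution function at a point.**  Same
setting; `F_π(t−) = π(O < t)`.  Then
`P_{μ₀}(δ ≤ #{i<N : O(X_i) < t}/N − F_π(t−)) ≤ exp(−(Nδ − 8/ε)²/(32N/ε²))`. [ours]
(`chain_tail_le_exp_of_doeblin` for `f = 1{O < t}`) -/
theorem chain_measureReal_edfStrict_sub_leftLim_ge_le (hπ : Kernel.Invariant κ π) {ε : ℝ≥0∞}
    (hmin : ∀ x {B : Set Ω}, MeasurableSet B → ε * π B ≤ κ x B) (hε0 : 0 < ε)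
    {O : Ω → ℝ} (hO : Measurable O) (t : ℝ) {N : ℕ} (hN : N ≠ 0) {δ : ℝ}
    (hδ : 8 / ε.toReal ≤ N * δ) :
    (Kernel.trajMeasure (X := fun _ : ℕ => Ω) μ₀
          (fun m : ℕ => κ.comap (fun y : (i : ↥(Finset.Iic m)) → Ω => y ⟨m, Finset.mem_Iic.2 le_rfl⟩)
            (measurable_pi_apply _))).real
        {x | δ ≤ (∑ i ∈ range N, (Set.Iio t).indicator (1 : ℝ → ℝ) (O (x i))) / N
            - Function.leftLim (cdf (π.map O)) t}
      ≤ Real.exp (-(N * δ - 8 / ε.toReal) ^ 2 / (32 * N / ε.toReal ^ 2)) := by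
  haveI : IsProbabilityMeasure (π.map O) := Measure.isProbabilityMeasure_map hO.aemeasurable
  set P := Kernel.trajMeasure (X := fun _ : ℕ => Ω) μ₀
      (fun m : ℕ => κ.comap (fun y : (i : ↥(Finset.Iic m)) → Ω => y ⟨m, Finset.mem_Iic.2 le_rfl⟩)
        (measurable_pi_apply _)) with hP
  have hIm : Measurable ((Set.Iio t).indicator (1 : ℝ → ℝ)) :=
    measurable_one.indicator measurableSet_Iio
  have hfm : Measurable (fun z => (Set.Iio t).indicator (1 : ℝ → ℝ) (O z)) := hIm.comp hO
  -- the mean of `1{O < t}` under `π` is `F_π(t−)`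
  have hint : ∫ z, (Set.Iio t).indicator (1 : ℝ → ℝ) (O z) ∂π
      = Function.leftLim (cdf (π.map O)) t := by
    rw [← integral_map hO.aemeasurable hIm.aestronglyMeasurable,
      integral_indicator_one measurableSet_Iio, leftLim_cdf_eq_real]
  have hL0 : 0 ≤ Function.leftLim (cdf (π.map O)) t := by
    rw [leftLim_cdf_eq_real]; exact measureReal_nonneg
  have hL1 : Function.leftLim (cdf (π.map O)) t ≤ 1 := by
    rw [leftLim_cdf_eq_real]; exact measureReal_le_one
  have hC : ∀ z, |(Set.Iio t).indicator (1 : ℝ → ℝ) (O z)|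
      ≤ 2 - |∫ z, (Set.Iio t).indicator (1 : ℝ → ℝ) (O z) ∂π| := by
    intro z
    rw [hint, abs_of_nonneg (indicator_one_nonneg _ _), abs_of_nonneg hL0]
    linarith [indicator_one_le_one (Set.Iio t) (O z)]
  have h42 : (4 : ℝ) * 2 = 8 := by norm_num
  have hs : 4 * ((2 - |∫ z, (Set.Iio t).indicator (1 : ℝ → ℝ) (O z) ∂π|)
      + |∫ z, (Set.Iio t).indicator (1 : ℝ → ℝ) (O z) ∂π|) / ε.toReal ≤ N * δ := by
    rw [sub_add_cancel, h42]
    exact hδ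
  have h := chain_tail_le_exp_of_doeblin (μ₀ := μ₀) hπ hmin hε0 hfm hC hN hs
  beta_reduce at h
  rw [← hP, sub_add_cancel, h42, hint] at h
  refine h.trans (le_of_eq ?_)
  congr 1
  ring

end Point

/-! ## §2 The uniform band along the chain -/

section Band

/-- **THE UNIFORM BAND ALONG A DOEBLIN CHAIN (grid form).**  `π` invariant for `κ`,
`κ(x, ·) ≥ ε π` (`ε > 0`), `O` measurable, `F_π = cdf (π ∘ O⁻¹)` (atoms allowed),
`F̂_N(t) = #{i<N : O(X_i) ≤ t}/N`; `K ≥ 1`, `δ > 0`, `N ≠ 0`, `Nδ ≥ 8/ε`.  From any initial law,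
`P_{μ₀}(∃ t, δ + 1/K ≤ |F_π(t) − F̂_N(t)|) ≤ 2(K + 1)·exp(−(Nδ − 8/ε)²/(32N/ε²))`. [ours]
(outside the `2(K + 1)` one-point tail events at the quantile grid of `F_π` the one-function
sandwich `abs_cdf_sub_lt_of_grid` bounds every deviation; union bound; outer measure) -/
theorem chain_measureReal_exists_edf_dev_ge_le (hπ : Kernel.Invariant κ π) {ε : ℝ≥0∞}
    (hmin : ∀ x {B : Set Ω}, MeasurableSet B → ε * π B ≤ κ x B) (hε0 : 0 < ε)
    {O : Ω → ℝ} (hO : Measurable O) {K : ℕ} (hK : 1 ≤ K) {N : ℕ} (hN : N ≠ 0) {δ : ℝ}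
    (hδ0 : 0 < δ) (hδ : 8 / ε.toReal ≤ N * δ) :
    (Kernel.trajMeasure (X := fun _ : ℕ => Ω) μ₀
          (fun m : ℕ => κ.comap (fun y : (i : ↥(Finset.Iic m)) → Ω => y ⟨m, Finset.mem_Iic.2 le_rfl⟩)
            (measurable_pi_apply _))).real
        {x | ∃ t : ℝ, δ + 1 / K ≤ |cdf (π.map O) t
            - (∑ i ∈ range N, (Set.Iic t).indicator (1 : ℝ → ℝ) (O (x i))) / N|}
      ≤ 2 * ((K : ℝ) + 1) * Real.exp (-(N * δ - 8 / ε.toReal) ^ 2 / (32 * N / ε.toReal ^ 2)) := by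
  haveI : IsProbabilityMeasure (π.map O) := Measure.isProbabilityMeasure_map hO.aemeasurable
  set P := Kernel.trajMeasure (X := fun _ : ℕ => Ω) μ₀
      (fun m : ℕ => κ.comap (fun y : (i : ↥(Finset.Iic m)) → Ω => y ⟨m, Finset.mem_Iic.2 le_rfl⟩)
        (measurable_pi_apply _)) with hP
  set ρ : Measure ℝ := π.map O with hρ
  set q : ℕ → ℝ := fun j => sInf {x | (j : ℝ) / K ≤ cdf ρ x} with hq
  -- the grid events
  set A : ℕ → Set (ℕ → Ω) := fun j => {x | δ ≤ cdf ρ (q j)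
    - (∑ i ∈ range N, (Set.Iic (q j)).indicator (1 : ℝ → ℝ) (O (x i))) / N} with hA
  set B : ℕ → Set (ℕ → Ω) := fun j => {x | δ ≤ (∑ i ∈ range N,
    (Set.Iio (q j)).indicator (1 : ℝ → ℝ) (O (x i))) / N - Function.leftLim (cdf ρ) (q j)} with hB
  have hsub : {x : ℕ → Ω | ∃ t : ℝ, δ + 1 / K ≤ |cdf ρ t
        - (∑ i ∈ range N, (Set.Iic t).indicator (1 : ℝ → ℝ) (O (x i))) / N|}
      ⊆ ⋃ j ∈ Finset.range (K + 1), (A j ∪ B j) := by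
    rintro x ⟨t, ht⟩
    by_contra hgood
    have hnot : ∀ j, j ≤ K → x ∉ A j ∧ x ∉ B j := by
      intro j hj
      have hjm : j ∈ Finset.range (K + 1) := Finset.mem_range.2 (by omega)
      exact ⟨fun h => hgood (Set.mem_iUnion₂.2 ⟨j, hjm, Set.mem_union_left _ h⟩),
        fun h => hgood (Set.mem_iUnion₂.2 ⟨j, hjm, Set.mem_union_right _ h⟩)⟩
    have hlt := abs_cdf_sub_lt_of_grid ρ
      (F₁ := fun s => (∑ i ∈ range N, (Set.Iic s).indicator (1 : ℝ → ℝ) (O (x i))) / N)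
      (G₁ := fun s => (∑ i ∈ range N, (Set.Iio s).indicator (1 : ℝ → ℝ) (O (x i))) / N)
      (fun u v huv => div_le_div_of_nonneg_right (sum_le_sum fun i _ => indicator_Iic_mono _ huv)
        (Nat.cast_nonneg N))
      (fun s => div_nonneg (sum_nonneg fun i _ => indicator_one_nonneg _ _) (Nat.cast_nonneg N))
      (fun s => div_le_one_of_le₀ ((sum_le_sum fun i _ => indicator_one_le_one _ _).trans
        (by simp)) (Nat.cast_nonneg N))
      (fun u v huv => div_le_div_of_nonneg_right (sum_le_sum fun i _ => indicator_Iic_le_Iio huv _)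
        (Nat.cast_nonneg N))
      hK hδ0
      (fun j hj => by
        have h := (hnot j hj).1
        simp only [hA, Set.mem_setOf_eq, not_le] at h
        linarith)
      (fun j hj => by
        have h := (hnot j hj).2
        simp only [hB, Set.mem_setOf_eq, not_le] at h
        linarith)
      t
    exact absurd ht (not_le.2 hlt)
  have hAj : ∀ j, P.real (A j)
      ≤ Real.exp (-(N * δ - 8 / ε.toReal) ^ 2 / (32 * N / ε.toReal ^ 2)) := fun j =>
    chain_measureReal_cdf_sub_edf_ge_le (μ₀ := μ₀) hπ hmin hε0 hO (q j) hN hδ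
  have hBj : ∀ j, P.real (B j)
      ≤ Real.exp (-(N * δ - 8 / ε.toReal) ^ 2 / (32 * N / ε.toReal ^ 2)) := fun j =>
    chain_measureReal_edfStrict_sub_leftLim_ge_le (μ₀ := μ₀) hπ hmin hε0 hO (q j) hN hδ
  calc P.real {x : ℕ → Ω | ∃ t : ℝ, δ + 1 / K ≤ |cdf ρ t
          - (∑ i ∈ range N, (Set.Iic t).indicator (1 : ℝ → ℝ) (O (x i))) / N|}
      ≤ P.real (⋃ j ∈ Finset.range (K + 1), (A j ∪ B j)) :=
        measureReal_mono hsub (measure_ne_top _ _)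
    _ ≤ ∑ j ∈ Finset.range (K + 1), P.real (A j ∪ B j) := measureReal_biUnion_finset_le _ _
    _ ≤ ∑ j ∈ Finset.range (K + 1),
          (Real.exp (-(N * δ - 8 / ε.toReal) ^ 2 / (32 * N / ε.toReal ^ 2))
            + Real.exp (-(N * δ - 8 / ε.toReal) ^ 2 / (32 * N / ε.toReal ^ 2))) :=
        sum_le_sum fun j _ => (measureReal_union_le _ _).trans (add_le_add (hAj j) (hBj j))
    _ = 2 * ((K : ℝ) + 1)
          * Real.exp (-(N * δ - 8 / ε.toReal) ^ 2 / (32 * N / ε.toReal ^ 2)) := by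
        rw [Finset.sum_const, Finset.card_range, nsmul_eq_mul]
        push_cast
        ring

/-- **THE UNIFORM BAND ALONG A DOEBLIN CHAIN (`η` form).**  Same setting; `η > 0`, `N ≠ 0`,
`Nη ≥ 16/ε`.  From any initial law,
`P_{μ₀}(∃ t, η ≤ |F_π(t) − F̂_N(t)|) ≤ 2(⌈2/η⌉ + 1)·exp(−(Nη − 16/ε)²/(128N/ε²))`. [ours]
(`δ = η/2`, `K = ⌈2/η⌉`) -/
theorem chain_measureReal_exists_edf_dev_ge_le_of_pos (hπ : Kernel.Invariant κ π) {ε : ℝ≥0∞}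
    (hmin : ∀ x {B : Set Ω}, MeasurableSet B → ε * π B ≤ κ x B) (hε0 : 0 < ε)
    {O : Ω → ℝ} (hO : Measurable O) {N : ℕ} (hN : N ≠ 0) {η : ℝ} (hη : 0 < η)
    (hNη : 16 / ε.toReal ≤ N * η) :
    (Kernel.trajMeasure (X := fun _ : ℕ => Ω) μ₀
          (fun m : ℕ => κ.comap (fun y : (i : ↥(Finset.Iic m)) → Ω => y ⟨m, Finset.mem_Iic.2 le_rfl⟩)
            (measurable_pi_apply _))).real
        {x | ∃ t : ℝ, η ≤ |cdf (π.map O) t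
            - (∑ i ∈ range N, (Set.Iic t).indicator (1 : ℝ → ℝ) (O (x i))) / N|}
      ≤ 2 * ((⌈2 / η⌉₊ : ℝ) + 1)
          * Real.exp (-(N * η - 16 / ε.toReal) ^ 2 / (128 * N / ε.toReal ^ 2)) := by
  set K : ℕ := ⌈2 / η⌉₊ with hK
  have hKpos : 1 ≤ K :=
    Nat.one_le_iff_ne_zero.2 (Nat.pos_iff_ne_zero.1 (Nat.ceil_pos.2 (by positivity)))
  have hK0 : (0 : ℝ) < K := by exact_mod_cast hKpos
  have hKη : 1 / (K : ℝ) ≤ η / 2 := by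
    have hle : 2 / η ≤ (K : ℝ) := Nat.le_ceil _
    rw [div_le_iff₀ hK0]
    rw [div_le_iff₀ hη] at hle
    linarith [mul_comm (K : ℝ) η]
  have hδ : 8 / ε.toReal ≤ N * (η / 2) := by
    have : (16 : ℝ) / ε.toReal = 2 * (8 / ε.toReal) := by ring
    linarith
  have h := chain_measureReal_exists_edf_dev_ge_le (μ₀ := μ₀) hπ hmin hε0 hO hKpos hN
    (half_pos hη) hδ
  have hsub : {x : ℕ → Ω | ∃ t : ℝ, η ≤ |cdf (π.map O) t
        - (∑ i ∈ range N, (Set.Iic t).indicator (1 : ℝ → ℝ) (O (x i))) / N|}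
      ⊆ {x | ∃ t : ℝ, η / 2 + 1 / K ≤ |cdf (π.map O) t
        - (∑ i ∈ range N, (Set.Iic t).indicator (1 : ℝ → ℝ) (O (x i))) / N|} := by
    rintro x ⟨t, ht⟩
    exact ⟨t, le_trans (by linarith) ht⟩
  refine (measureReal_mono hsub).trans (h.trans (le_of_eq ?_))
  congr 1
  congr 1
  ring

end Band

/-! ## §3 All sample quantiles of the chain output at once -/

section Quantiles

/-- **ALL SAMPLE QUANTILES OF THE CHAIN OUTPUT AT ONCE.**  Same setting; population lower
quantiles `q_π(v) = inf{x : v ≤ F_π(x)}`, empirical lower quantiles of the first `N` states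
`q̂_N(u) = inf{x : u ≤ cdf(N⁻¹Σ_{i<N} δ_{O(X_i)}) x}`; `η > 0`, `N ≠ 0`, `Nη ≥ 16/ε`.  From any
initial law,
`P_{μ₀}(∃ u, η < u ∧ u + η < 1 ∧ ¬(q_π(u − η) ≤ q̂_N(u) ≤ q_π(u + η)))
   ≤ 2(⌈2/η⌉ + 1)·exp(−(Nη − 16/ε)²/(128N/ε²))`. [ours] (on the complement of the band event every
bracket holds, by `quantile_bracket_of_abs_cdf_sub_lt` for `π ∘ O⁻¹` and the empirical measure) -/
theorem chain_measureReal_exists_quantile_unbracketed_le (hπ : Kernel.Invariant κ π) {ε : ℝ≥0∞}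
    (hmin : ∀ x {B : Set Ω}, MeasurableSet B → ε * π B ≤ κ x B) (hε0 : 0 < ε)
    {O : Ω → ℝ} (hO : Measurable O) {N : ℕ} (hN : N ≠ 0) {η : ℝ} (hη : 0 < η)
    (hNη : 16 / ε.toReal ≤ N * η) :
    (Kernel.trajMeasure (X := fun _ : ℕ => Ω) μ₀
          (fun m : ℕ => κ.comap (fun y : (i : ↥(Finset.Iic m)) → Ω => y ⟨m, Finset.mem_Iic.2 le_rfl⟩)
            (measurable_pi_apply _))).real
        {x | ∃ u : ℝ, η < u ∧ u + η < 1 ∧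
          ¬ (sInf {y | u - η ≤ cdf (π.map O) y}
                ≤ sInf {y | u ≤ cdf (((N : ℝ≥0∞)⁻¹) • ∑ i ∈ range N, Measure.dirac (O (x i))) y}
              ∧ sInf {y | u ≤ cdf (((N : ℝ≥0∞)⁻¹) • ∑ i ∈ range N, Measure.dirac (O (x i))) y}
                ≤ sInf {y | u + η ≤ cdf (π.map O) y})}
      ≤ 2 * ((⌈2 / η⌉₊ : ℝ) + 1)
          * Real.exp (-(N * η - 16 / ε.toReal) ^ 2 / (128 * N / ε.toReal ^ 2)) := by
  haveI : IsProbabilityMeasure (π.map O) := Measure.isProbabilityMeasure_map hO.aemeasurable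
  have hN1 : 1 ≤ N := Nat.one_le_iff_ne_zero.2 hN
  refine le_trans (measureReal_mono ?_)
    (chain_measureReal_exists_edf_dev_ge_le_of_pos (μ₀ := μ₀) hπ hmin hε0 hO hN hη hNη)
  rintro x ⟨u, hηu, huη, hnot⟩
  by_contra hgood
  simp only [Set.mem_setOf_eq, not_exists, not_le] at hgood
  haveI := isProbabilityMeasure_empiricalMeasure (fun i => O (x i)) hN1
  refine hnot (quantile_bracket_of_abs_cdf_sub_lt (π.map O)
    (((N : ℝ≥0∞)⁻¹) • ∑ i ∈ range N, Measure.dirac (O (x i))) hη hηu huη fun t => ?_)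
  rw [cdf_empiricalMeasure (fun i => O (x i)) hN1 t]
  exact hgood t

end Quantiles


/-! ## §4 The exact flow sampler (independence Metropolis) under a weight ceiling -/

section FlowSampler

open Summit.Ventures.LatticeQCDFlow.Exactness

/-- **THE PRINTED DISTRIBUTION FUNCTION OF AN EXACT FLOW SAMPLER HAS A CERTIFIED BAND.**  Model
law `q` (the flow's output), weight `w = dπ/dq` measurable, `0 < w ≤ M`, `π = w · q` a probability
law; `K = indepMH q w` is EXACT for `π` (`indepMH_invariant`) and Doeblin with `ε = 1/M`
(`indepMH_apply_ge`).  For all measurable real `O`, initial laws `μ₀`, `N ≠ 0`, `η > 0`, `Nη ≥ 16M`: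
`P_{μ₀}(∃ t, η ≤ |F_π(t) − #{i<N : O(X_i) ≤ t}/N|) ≤ 2(⌈2/η⌉ + 1)·exp(−(Nη − 16M)²/(128 N M²))`.
[ours] -/
theorem indepMH_measureReal_exists_edf_dev_ge_le {q : Measure Ω} [IsProbabilityMeasure q]
    {w : Ω → ℝ} [hwF : Fact (Measurable w)] (hw0 : ∀ x, 0 < w x) {M : ℝ} (hM : ∀ x, w x ≤ M)
    [IsProbabilityMeasure (q.withDensity fun y => ENNReal.ofReal (w y))]
    {O : Ω → ℝ} (hO : Measurable O) {N : ℕ} (hN : N ≠ 0) {η : ℝ} (hη : 0 < η)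
    (hNη : 16 * M ≤ N * η) :
    (Kernel.trajMeasure (X := fun _ : ℕ => Ω) μ₀
          (fun m : ℕ => (indepMH q w).comap
            (fun y : (i : ↥(Finset.Iic m)) → Ω => y ⟨m, Finset.mem_Iic.2 le_rfl⟩)
            (measurable_pi_apply _))).real
        {x | ∃ t : ℝ, η ≤ |cdf ((q.withDensity fun y => ENNReal.ofReal (w y)).map O) t
            - (∑ i ∈ range N, (Set.Iic t).indicator (1 : ℝ → ℝ) (O (x i))) / N|}
      ≤ 2 * ((⌈2 / η⌉₊ : ℝ) + 1)
          * Real.exp (-(N * η - 16 * M) ^ 2 / (128 * N * M ^ 2)) := by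
  have hw : Measurable w := hwF.out
  obtain ⟨x0⟩ := nonempty_of_isProbabilityMeasure q
  have hM0 : 0 < M := (hw0 x0).trans_le (hM x0)
  have hinv := indepMH_invariant (q := q) hw hw0
  have hmin : ∀ x {B : Set Ω}, MeasurableSet B →
      (ENNReal.ofReal M)⁻¹ * (q.withDensity fun y => ENNReal.ofReal (w y)) B ≤ indepMH q w x B :=
    fun x B hB => indepMH_apply_ge (q := q) hw hw0 hM x hB
  have hε0 : 0 < (ENNReal.ofReal M)⁻¹ := ENNReal.inv_pos.2 ENNReal.ofReal_ne_top
  have hε : ((ENNReal.ofReal M)⁻¹).toReal = M⁻¹ := by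
    rw [ENNReal.toReal_inv, ENNReal.toReal_ofReal hM0.le]
  have hNη' : 16 / ((ENNReal.ofReal M)⁻¹).toReal ≤ N * η := by
    rw [hε, div_inv_eq_mul]
    exact hNη
  have h := chain_measureReal_exists_edf_dev_ge_le_of_pos (μ₀ := μ₀) hinv hmin hε0 hO hN hη hNη'
  rw [hε] at h
  refine h.trans (le_of_eq ?_)
  congr 1
  congr 1
  field_simp

end FlowSampler

end Summit.Ventures.LatticeQCDFlow.Scoring.GlivenkoCantelli

end
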